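/-
b2b-lace packet, ANALYTIC ORACLE seat gen 8 (unit `b2b-lace-oracle-g8`).  The x-space content of
[NoBLE17] (3.28)–(3.30): the weighted simple-random-walk line `Σ_y |y|² C(y) I_{n,l}(x − y)` IS the
table object `𝓙_{n,l}(x) = srwJ d (n+2) l x`.  No Fourier derivative is taken: the printed k-space step
"−Δ_k Ĉ(k) = Ĉ(k)² M̂(k)" is replaced by an elementary identity for the SRW transition probabilities.
-/
import Literature.Probability.FitznerVanDerHofstad2017.SrwIntegralJFarField
import Literature.Probability.FitznerVanDerHofstad2017.SrwLawBridges
import Literature.Probability.RandomPlanarGeometry.BDGS2012MeanSqDisplacement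
import HarnessLib

/-!
# The weighted SRW line against the majorant integrals: `Σ_y |y|² C(y) I_{n,l}(x−y) = 𝓙_{n,l}(x)`

CITATION HEADER (PLACEMENT v2). This module is part of a certified REPRODUCTION of
R. Fitzner, R. van der Hofstad, *Generalized approach to the non-backtracking lace expansion*,
Probab. Theory Related Fields 169 (2017) 1041–1119 [NoBLE17] (= arXiv:1506.07969, cited in that
numbering), §3.3.3 "Bound on the initial condition for f₃", display (3.28)–(3.30) p. 1070:

> "we first note that `|x|² C_{1/(2d)}(x)` has Fourier transform `−Δ_k Ĉ_{1/2d}(k)`, where `Δ_k` is the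
> Laplacian w.r.t. `k`" … "`∫ (−Δ_k Ĉ(k)) D̂^l(k) Ĉ(k)^n e^{ik·x} d^dk/(2π)^d = 𝓙_{n,l}(x)`, where
> `𝓙_{n,l}(x) := I_{n+2,l+1}(x) − (1/d) I_{n+3,l}(x) + (1/(2d²)) Σ_ι I_{n+3,l}(x + 2e_ι)`"  (3.29)–(3.30).

## What is proved (d-generic; no dimension sentence is made in this file)

With `p_m = SRW.prob d m` the `m`-step law, `C(y) = Σ_m p_m(y)` the critical SRW Green's function,
`I_{n,l} = srwI d n l` (`SrwIntegralBounds`) and `𝓙 = srwJ` (`SrwIntegralJFarField`):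

* `normSq_mul_prob_add_two` — the **second-moment identity of the `m`-step law**
  `|x|² p_{m}(x) = m p_m(x) + (m(m−1)/(2d)) [ (2d)⁻¹ Σ_e p_{m−2}(x − 2e) − p_{m−2}(x) ]`
  (elementary: `|ω(m)|² = m + Σ_{s≠t} ξ_s·ξ_t` for a walk with steps `ξ`, and the law of two marked
  steps; proved here by induction on `m` through the first-moment identity
  `⟨e, x⟩ p_m(x) = (m/(2d)) [p_{m−1}(x − e) − p_{m−1}(x + e)]`, `dirDot_mul_prob_succ`);
* `tsum_prob_mul_srwI` — `Σ_y p_m(y) I_{n,l}(x − y) = I_{n,l+m}(x)` and `hasSum_prob_srwI_one` —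
  `C(y) = I_{1,0}(y)`; `hasSum_succ_mul_srwI`, `hasSum_succ_mul_succ_mul_srwI` — the resummations
  `I_{n+2,l} = Σ_m (m+1) I_{n,l+m}`, `2 I_{n+3,l} = Σ_m (m+1)(m+2) I_{n,l+m}` (from the tail identity
  `I_{n+1,l} = Σ_{j} I_{n,l+j}` of `SrwIntegralMonotone`);
* `hasSum_weightedLine` / `tsum_weightedLine_eq_srwJ` — for `2(n+3)+1 ≤ d`:
  `Σ_y |y|² C(y) I_{n,l}(x − y) = srwJ d (n+2) l x`, the family being summable; in particular
  `srwJ d (n+2) l x ≥ 0` (`srwJ_nonneg`); and `hasSum_green_mul_srwI` — the x-space convolution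
  identity `Σ_v C(v) I_{m,l}(w − v) = I_{m+1,l}(w)` (`C ⋆ I_{m,l} = I_{m+1,l}`).

These are the ingredients of the initial-point bound (3.31) on `f₃(p_I)` (module
`NobleF3InitialPoint`).  Everything here is a statement about simple random walk only.
-/

noncomputable section

namespace Literature.Probability.FitznerVanDerHofstad2017

open Filter Topology Finset
open Literature.Probability.LatticeModels
open Literature.Barriers.CriticalPhenomena
open Literature.Probability.RandomPlanarGeometry.SAW.Zd (normSq normSq_nonneg)
open scoped BigOperators

variable {d : ℕ}

/-! ### Elementary objects: `|x|²`, `⟨e, x⟩`, the one-step average and the two-step shift -/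

-- `|x|² = Σ_i x_i²` as a real number is the tree's `SAW.Zd.normSq` (`BDGS2012`), reused here.

/-- `euclidNorm x ^ 2 = normSq x`. [folklore] -/
theorem euclidNorm_sq_eq_normSq (x : Site d) : euclidNorm x ^ 2 = normSq x := by
  rw [euclidNorm, Real.sq_sqrt (Finset.sum_nonneg fun i _ => sq_nonneg _)]; rfl

/-- `|0|² = 0`. [folklore] -/
@[simp] theorem normSq_zero : normSq (0 : Site d) = 0 := by simp [normSq]

/-- The sign `±1` of a unit step. [folklore] -/
def dirSign (v : SRW.Dir d) : ℝ := if v.2 then 1 else -1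

/-- `⟨e_v, y⟩`: the signed coordinate of `y` along the unit step `e_v`. [folklore] -/
def dirDot (v : SRW.Dir d) (y : Site d) : ℝ := dirSign v * ((y v.1 : ℤ) : ℝ)

/-- The coordinates of a unit step, as reals. [folklore] -/
theorem stepVec_apply_real (v : SRW.Dir d) (i : Fin d) :
    (((SRW.stepVec v) i : ℤ) : ℝ) = if i = v.1 then dirSign v else 0 := by
  rw [SRW.stepVec_apply]
  unfold dirSign
  split_ifs <;> simp

/-- `⟨e, 0⟩ = 0`. [folklore] -/
@[simp] theorem dirDot_zero (v : SRW.Dir d) : dirDot v 0 = 0 := by simp [dirDot]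

/-- `⟨e, a + b⟩ = ⟨e, a⟩ + ⟨e, b⟩`. [folklore] -/
theorem dirDot_add (v : SRW.Dir d) (a b : Site d) : dirDot v (a + b) = dirDot v a + dirDot v b := by
  simp [dirDot, mul_add]

/-- `⟨e, a − b⟩ = ⟨e, a⟩ − ⟨e, b⟩`. [folklore] -/
theorem dirDot_sub (v : SRW.Dir d) (a b : Site d) : dirDot v (a - b) = dirDot v a - dirDot v b := by
  simp [dirDot, mul_sub]

/-- `(±1)² = 1`. [folklore] -/
theorem dirSign_mul_self (v : SRW.Dir d) : dirSign v * dirSign v = 1 := by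
  unfold dirSign; split_ifs <;> norm_num

/-- `⟨e_v, e_w⟩ = ±[same axis]`. [folklore] -/
theorem dirDot_stepVec (v w : SRW.Dir d) :
    dirDot v (SRW.stepVec w) = if v.1 = w.1 then dirSign v * dirSign w else 0 := by
  unfold dirDot
  rw [stepVec_apply_real]
  split_ifs <;> simp

/-- `Σ_w ⟨e_v, e_w⟩ F(w) = F(v) − F(−v)`. [folklore] -/
theorem sum_dirDot_stepVec_mul (v : SRW.Dir d) (F : SRW.Dir d → ℝ) :
    ∑ w, dirDot v (SRW.stepVec w) * F w = F v - F v.neg := by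
  simp_rw [dirDot_stepVec]
  rw [Fintype.sum_prod_type]
  simp only [Fintype.sum_bool]
  rw [Finset.sum_eq_single v.1]
  · rcases v with ⟨j, b⟩
    cases b <;> simp [dirSign, SRW.Dir.neg] <;> ring
  · intro j _ hj; simp [Ne.symm hj]
  · intro h; exact absurd (Finset.mem_univ _) h

/-- `|z + e_v|² = |z|² + 2⟨e_v, z⟩ + 1`. [folklore] -/
theorem normSq_add_stepVec (z : Site d) (v : SRW.Dir d) :
    normSq (z + SRW.stepVec v) = normSq z + 2 * dirDot v z + 1 := by
  unfold normSq
  have : ∀ i, (((z + SRW.stepVec v) i : ℤ) : ℝ) ^ 2 =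
      ((z i : ℤ) : ℝ) ^ 2 + (2 * (if i = v.1 then dirSign v else 0) * ((z i : ℤ) : ℝ)
        + (if i = v.1 then dirSign v else 0) ^ 2) := by
    intro i
    rw [Pi.add_apply, Int.cast_add, stepVec_apply_real]; ring
  simp_rw [this]
  have h2 : ∑ i, (2 * (if i = v.1 then dirSign v else 0) * ((z i : ℤ) : ℝ)
      + (if i = v.1 then dirSign v else 0) ^ 2) = 2 * dirDot v z + 1 := by
    rw [Finset.sum_eq_single v.1]
    · rw [if_pos rfl]
      unfold dirDot
      have := dirSign_mul_self v
      nlinarith [this]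
    · intro i _ hi; simp [hi]
    · intro h; exact absurd (Finset.mem_univ _) h
  rw [Finset.sum_add_distrib, h2]; ring

/-- The one-step average `(2d)⁻¹ Σ_e f(x − e)` (so that `p_{m+1} = avg p_m`). [folklore] -/
def stepAvg (f : Site d → ℝ) (x : Site d) : ℝ := (∑ w, f (x - SRW.stepVec w)) / (2 * d)

/-- The two-step shift average `(2d)⁻¹ Σ_e f(x − 2e)`. [folklore] -/
def shiftTwo (f : Site d → ℝ) (x : Site d) : ℝ := (∑ w, f (x - 2 • SRW.stepVec w)) / (2 * d)

/-- `p_{m+1} = avg p_m`. [folklore] -/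
theorem prob_succ_eq_stepAvg (m : ℕ) (x : Site d) :
    SRW.prob d (m + 1) x = stepAvg (SRW.prob d m) x := prob_succ_eq_sum_dir m x

/-- The one-step average and the two-step shift commute. [folklore] -/
theorem stepAvg_shiftTwo (f : Site d → ℝ) (x : Site d) :
    stepAvg (shiftTwo f) x = shiftTwo (stepAvg f) x := by
  unfold stepAvg shiftTwo
  simp_rw [Finset.sum_div]
  rw [Finset.sum_comm]
  refine Finset.sum_congr rfl fun w _ => ?_
  refine Finset.sum_congr rfl fun u _ => ?_
  rw [sub_right_comm]

/-! ### The first-moment identity `⟨e, x⟩ p_{m+1}(x) = ((m+1)/(2d)) [p_m(x − e) − p_m(x + e)]` -/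

/-- One-step decomposition of `2d ⟨e_v, y⟩ p_{m+1}(y)`. [folklore] -/
theorem dirDot_mul_prob_succ_decomp (hd : 1 ≤ d) (v : SRW.Dir d) (m : ℕ) (y : Site d) :
    2 * d * (dirDot v y * SRW.prob d (m + 1) y) =
      (∑ w, dirDot v (y - SRW.stepVec w) * SRW.prob d m (y - SRW.stepVec w))
        + (SRW.prob d m (y - SRW.stepVec v) - SRW.prob d m (y + SRW.stepVec v)) := by
  have hd' : (2 * d : ℝ) ≠ 0 := by
    have : (1 : ℝ) ≤ d := by exact_mod_cast hd
    positivity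
  rw [prob_succ_eq_sum_dir, mul_comm (2 * (d : ℝ)), mul_assoc, div_mul_cancel₀ _ hd',
    Finset.mul_sum]
  have hsplit : ∀ w, dirDot v y * SRW.prob d m (y - SRW.stepVec w) =
      dirDot v (y - SRW.stepVec w) * SRW.prob d m (y - SRW.stepVec w)
        + dirDot v (SRW.stepVec w) * SRW.prob d m (y - SRW.stepVec w) := by
    intro w
    rw [← add_mul, ← dirDot_add, sub_add_cancel]
  simp_rw [hsplit]
  rw [Finset.sum_add_distrib, sum_dirDot_stepVec_mul v (fun w => SRW.prob d m (y - SRW.stepVec w))]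
  simp [sub_neg_eq_add]

/-- **First-moment identity of the `m`-step law**:
`2d ⟨e_v, y⟩ p_{m+1}(y) = (m+1) [p_m(y − e_v) − p_m(y + e_v)]`. [folklore] -/
theorem dirDot_mul_prob_succ (hd : 1 ≤ d) (v : SRW.Dir d) :
    ∀ (m : ℕ) (y : Site d), 2 * d * (dirDot v y * SRW.prob d (m + 1) y) =
      (m + 1) * (SRW.prob d m (y - SRW.stepVec v) - SRW.prob d m (y + SRW.stepVec v)) := by
  have hd' : (2 * d : ℝ) ≠ 0 := by
    have : (1 : ℝ) ≤ d := by exact_mod_cast hd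
    positivity
  intro m
  induction m with
  | zero =>
    intro y
    rw [dirDot_mul_prob_succ_decomp hd]
    have h0 : ∀ w, dirDot v (y - SRW.stepVec w) * SRW.prob d 0 (y - SRW.stepVec w) = 0 := by
      intro w
      rw [SRW.prob_zero]
      split_ifs with h
      · rw [h]; simp
      · simp
    simp [h0]
  | succ m ih =>
    intro y
    rw [dirDot_mul_prob_succ_decomp hd]
    have h1 : ∀ w, dirDot v (y - SRW.stepVec w) * SRW.prob d (m + 1) (y - SRW.stepVec w) =
        ((m + 1) * (SRW.prob d m (y - SRW.stepVec v - SRW.stepVec w)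
          - SRW.prob d m (y + SRW.stepVec v - SRW.stepVec w))) / (2 * d) := by
      intro w
      rw [eq_div_iff hd', mul_comm _ (2 * (d : ℝ)), ih, sub_right_comm,
        add_sub_right_comm]
    simp_rw [h1]
    rw [← Finset.sum_div, ← Finset.mul_sum, Finset.sum_sub_distrib, mul_div_assoc, sub_div,
      ← prob_succ_eq_sum_dir, ← prob_succ_eq_sum_dir]
    push_cast
    ring

/-! ### The second-moment identity `|x|² p_m(x) = m p_m + (m(m−1)/(2d)) (S₂ p_{m−2} − p_{m−2})` -/

/-- The second-difference term `T_m(x) = (2d)⁻¹ Σ_e p_m(x − 2e) − p_m(x)`. [folklore] -/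
def probT (d m : ℕ) (x : Site d) : ℝ := shiftTwo (SRW.prob d m) x - SRW.prob d m x

/-- `Σ_w T_m(x − e_w) = 2d · T_{m+1}(x)`. [folklore] -/
theorem sum_probT_shift (hd : 1 ≤ d) (m : ℕ) (x : Site d) :
    ∑ w, probT d m (x - SRW.stepVec w) = 2 * d * probT d (m + 1) x := by
  have hd' : (2 * d : ℝ) ≠ 0 := by
    have : (1 : ℝ) ≤ d := by exact_mod_cast hd
    positivity
  have : probT d (m + 1) x = stepAvg (probT d m) x := by
    unfold probT
    rw [prob_succ_eq_stepAvg,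
      show shiftTwo (SRW.prob d (m + 1)) x = shiftTwo (stepAvg (SRW.prob d m)) x from by
        unfold shiftTwo; simp_rw [prob_succ_eq_stepAvg],
      ← stepAvg_shiftTwo]
    unfold stepAvg
    rw [← sub_div, ← Finset.sum_sub_distrib]
  rw [this]
  unfold stepAvg
  rw [mul_div_cancel₀ _ hd']

/-- The cross term `Σ_w ⟨e_w, x − e_w⟩ p_{m+1}(x − e_w) = (m+1) T_m(x)`. [folklore] -/
theorem sum_dirDot_shift_mul_prob_succ (hd : 1 ≤ d) (m : ℕ) (x : Site d) :
    ∑ w, dirDot w (x - SRW.stepVec w) * SRW.prob d (m + 1) (x - SRW.stepVec w) =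
      (m + 1) * probT d m x := by
  have hd' : (2 * d : ℝ) ≠ 0 := by
    have : (1 : ℝ) ≤ d := by exact_mod_cast hd
    positivity
  have h1 : ∀ w, dirDot w (x - SRW.stepVec w) * SRW.prob d (m + 1) (x - SRW.stepVec w) =
      ((m + 1) * (SRW.prob d m (x - 2 • SRW.stepVec w) - SRW.prob d m x)) / (2 * d) := by
    intro w
    rw [eq_div_iff hd', mul_comm _ (2 * (d : ℝ)), dirDot_mul_prob_succ hd, sub_add_cancel,
      two_smul, sub_sub]
  simp_rw [h1]
  rw [← Finset.sum_div, ← Finset.mul_sum, Finset.sum_sub_distrib, Finset.sum_const,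
    Finset.card_univ, SRW.card_dir, mul_div_assoc, sub_div]
  unfold probT shiftTwo
  congr 2
  rw [nsmul_eq_mul]; push_cast
  rw [mul_div_cancel_left₀ _ hd']

/-- The cross term vanishes at `m = 0`. [folklore] -/
theorem sum_dirDot_shift_mul_prob_zero (x : Site d) :
    ∑ w, dirDot w (x - SRW.stepVec w) * SRW.prob d 0 (x - SRW.stepVec w) = 0 := by
  refine Finset.sum_eq_zero fun w _ => ?_
  rw [SRW.prob_zero]
  split_ifs with h
  · rw [h]; simp
  · simp

/-- One-step recursion of `|x|² p_{m+1}(x)`. [folklore] -/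
theorem normSq_mul_prob_succ (hd : 1 ≤ d) (m : ℕ) (x : Site d) :
    2 * d * (normSq x * SRW.prob d (m + 1) x) =
      (∑ w, normSq (x - SRW.stepVec w) * SRW.prob d m (x - SRW.stepVec w))
        + 2 * d * SRW.prob d (m + 1) x
        + 2 * ∑ w, dirDot w (x - SRW.stepVec w) * SRW.prob d m (x - SRW.stepVec w) := by
  have hd' : (2 * d : ℝ) ≠ 0 := by
    have : (1 : ℝ) ≤ d := by exact_mod_cast hd
    positivity
  have hx : ∀ w, normSq x = normSq (x - SRW.stepVec w) + 2 * dirDot w (x - SRW.stepVec w) + 1 := by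
    intro w
    conv_lhs => rw [← sub_add_cancel x (SRW.stepVec w)]
    exact normSq_add_stepVec _ _
  rw [prob_succ_eq_sum_dir, mul_div_cancel₀ _ hd', mul_comm (2 * (d : ℝ)), mul_assoc,
    div_mul_cancel₀ _ hd', Finset.mul_sum]
  have : ∀ w, normSq x * SRW.prob d m (x - SRW.stepVec w) =
      normSq (x - SRW.stepVec w) * SRW.prob d m (x - SRW.stepVec w)
        + SRW.prob d m (x - SRW.stepVec w)
        + 2 * (dirDot w (x - SRW.stepVec w) * SRW.prob d m (x - SRW.stepVec w)) := by
    intro w; rw [hx w]; ring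
  simp_rw [this]
  rw [Finset.sum_add_distrib, Finset.sum_add_distrib, Finset.mul_sum]

/-- `|x|² p_0(x) = 0`. [folklore] -/
theorem normSq_mul_prob_zero (x : Site d) : normSq x * SRW.prob d 0 x = 0 := by
  rw [SRW.prob_zero]
  split_ifs with h
  · rw [h]; simp
  · simp

/-- `|x|² p_1(x) = p_1(x)`. [folklore] -/
theorem normSq_mul_prob_one (hd : 1 ≤ d) (x : Site d) : normSq x * SRW.prob d 1 x = SRW.prob d 1 x := by
  have hd' : (2 * d : ℝ) ≠ 0 := by
    have : (1 : ℝ) ≤ d := by exact_mod_cast hd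
    positivity
  have h := normSq_mul_prob_succ hd 0 x
  simp_rw [normSq_mul_prob_zero, sum_dirDot_shift_mul_prob_zero] at h
  simp only [Finset.sum_const_zero, zero_add, mul_zero, add_zero] at h
  exact mul_left_cancel₀ hd' h

/-- **Second-moment identity of the `m`-step law** ([NoBLE17] uses its Fourier form
`−Δ_k D̂(k)^m`): for every `m ≥ 0`,
`|x|² p_{m+2}(x) = (m+2) p_{m+2}(x) + ((m+2)(m+1)/(2d)) · [(2d)⁻¹ Σ_e p_m(x − 2e) − p_m(x)]`.
[cite: FitznerVanDerHofstad2016NoBLE, §3.3.3 (3.28)–(3.29) p. 1070] -/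
theorem normSq_mul_prob_add_two (hd : 1 ≤ d) :
    ∀ (m : ℕ) (x : Site d), normSq x * SRW.prob d (m + 2) x =
      (m + 2) * SRW.prob d (m + 2) x + (m + 2) * (m + 1) / (2 * d) * probT d m x := by
  have hd' : (2 * d : ℝ) ≠ 0 := by
    have : (1 : ℝ) ≤ d := by exact_mod_cast hd
    positivity
  intro m
  induction m with
  | zero =>
    intro x
    have h := normSq_mul_prob_succ hd 1 x
    simp_rw [normSq_mul_prob_one hd, sum_dirDot_shift_mul_prob_succ hd] at h
    have h2 : ∑ w, SRW.prob d 1 (x - SRW.stepVec w) = 2 * d * SRW.prob d 2 x := by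
      rw [prob_succ_eq_sum_dir 1 x, mul_div_cancel₀ _ hd']
    rw [h2] at h
    apply mul_left_cancel₀ hd'
    rw [h]
    field_simp
    ring
  | succ m ih =>
    intro x
    have h := normSq_mul_prob_succ hd (m + 2) x
    simp_rw [ih, sum_dirDot_shift_mul_prob_succ hd] at h
    rw [show (∑ w, ((m + 2 : ℝ) * SRW.prob d (m + 2) (x - SRW.stepVec w)
          + (m + 2) * (m + 1) / (2 * d) * probT d m (x - SRW.stepVec w)))
        = (m + 2) * (2 * d * SRW.prob d (m + 3) x) + (m + 2) * (m + 1) / (2 * d)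
            * (2 * d * probT d (m + 1) x) from by
        rw [Finset.sum_add_distrib, ← Finset.mul_sum, ← Finset.mul_sum, sum_probT_shift hd,
          prob_succ_eq_sum_dir (m + 2) x, mul_div_cancel₀ _ hd']] at h
    apply mul_left_cancel₀ hd'
    rw [h]
    field_simp
    push_cast
    ring

/-! ### The `m`-step law against the majorant integrals `I_{n,l}` -/

/-- **Chapman–Kolmogorov against `I_{n,l}`**: `Σ_{y ∈ box m} p_m(y) I_{n,l}(x − y) = I_{n,l+m}(x)`
(for `2n+1 ≤ d`; `n = 0` is `p_m ⋆ p_l = p_{l+m}`, the step `n → n+1` passes to the limit in the tail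
identity `I_{n+1,l} = Σ_j I_{n,l+j}`). [folklore] -/
theorem sum_box_prob_mul_srwI : ∀ (n : ℕ), 2 * n + 1 ≤ d → ∀ (m l : ℕ) (x : Site d),
    ∑ y ∈ box d m, SRW.prob d m y * srwI d n l (x - y) = srwI d n (l + m) x := by
  intro n
  induction n with
  | zero =>
    intro _ m l x
    simp_rw [srwI_zero_eq_srwLaw, ← prob_eq_srwLaw]
    rw [add_comm, SRW.prob_add m l x]
  | succ n ih =>
    intro hd m l x
    have hdn : 2 * n + 1 ≤ d := by omega
    have hlim : ∀ z, Tendsto (fun N => ∑ j ∈ Finset.range N, srwI d n (l + j) z) atTop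
        (𝓝 (srwI d (n + 1) l z)) := fun z => tendsto_sum_range_srwI (by omega) l z
    have h1 : Tendsto (fun N => ∑ y ∈ box d m, SRW.prob d m y *
        ∑ j ∈ Finset.range N, srwI d n (l + j) (x - y)) atTop
        (𝓝 (∑ y ∈ box d m, SRW.prob d m y * srwI d (n + 1) l (x - y))) :=
      tendsto_finsetSum _ fun y _ => (hlim (x - y)).const_mul _
    have h2 : Tendsto (fun N => ∑ j ∈ Finset.range N, srwI d n (l + m + j) x) atTop
        (𝓝 (srwI d (n + 1) (l + m) x)) := tendsto_sum_range_srwI (by omega) (l + m) x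
    have heq : (fun N => ∑ y ∈ box d m, SRW.prob d m y *
        ∑ j ∈ Finset.range N, srwI d n (l + j) (x - y))
        = fun N => ∑ j ∈ Finset.range N, srwI d n (l + m + j) x := by
      funext N
      simp_rw [Finset.mul_sum]
      rw [Finset.sum_comm]
      refine Finset.sum_congr rfl fun j _ => ?_
      rw [ih hdn m (l + j) x, add_right_comm]
    rw [heq] at h1
    exact tendsto_nhds_unique h1 h2

/-- The same with the sum over all of `ℤ^d` (`p_m` vanishes off the box). [folklore] -/
theorem tsum_prob_mul_srwI {n : ℕ} (hd : 2 * n + 1 ≤ d) (m l : ℕ) (x : Site d) :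
    ∑' y, SRW.prob d m y * srwI d n l (x - y) = srwI d n (l + m) x := by
  rw [tsum_eq_sum (s := box d m) fun y hy => by rw [SRW.prob_eq_zero_of_not_mem_box hy, zero_mul]]
  exact sum_box_prob_mul_srwI n hd m l x

/-- A family `y ↦ p_m(y) g(y)` is summable (finite support). [folklore] -/
theorem summable_prob_mul (m : ℕ) (g : Site d → ℝ) :
    Summable fun y => SRW.prob d m y * g y :=
  summable_of_ne_finset_zero (s := box d m) fun y hy => by
    rw [SRW.prob_eq_zero_of_not_mem_box hy, zero_mul]

/-- The tail identity as a `HasSum`: `I_{n+1,l}(x) = Σ_j I_{n,l+j}(x)` (`2(n+1)+1 ≤ d`).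
[cite: FitznerVanDerHofstad2016NoBLE, §2.1 (I_{n,l} as the n-fold tail sum) p. 1049] -/
theorem hasSum_srwI_tail {n : ℕ} (hd : 2 * (n + 1) + 1 ≤ d) (l : ℕ) (x : Site d) :
    HasSum (fun j => srwI d n (l + j) x) (srwI d (n + 1) l x) :=
  (hasSum_iff_tendsto_nat_of_nonneg (fun j => srwI_nonneg n (by omega) _ _) _).2
    (tendsto_sum_range_srwI hd l x)

/-- **The critical SRW Green's function is `I_{1,0}`**: `Σ_m p_m(y) = I_{1,0}(y)` (`d ≥ 3`).
[cite: FitznerVanDerHofstad2016NoBLE, §2.1 (C_{1/(2d)} = Σ_m D^{⋆m}) p. 1049] -/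
theorem hasSum_prob_srwI_one (hd : 3 ≤ d) (y : Site d) :
    HasSum (fun m => SRW.prob d m y) (srwI d 1 0 y) := by
  have h := hasSum_srwI_tail (n := 0) (d := d) (by omega) 0 y
  simp_rw [zero_add, srwI_zero_eq_srwLaw, ← prob_eq_srwLaw] at h
  exact h

/-- Antidiagonal resummation of a summable double series over `ℕ × ℕ`. [folklore] -/
theorem hasSum_sum_antidiagonal {F : ℕ × ℕ → ℝ} {a : ℝ} (hF : HasSum F a) :
    HasSum (fun N => ∑ p ∈ antidiagonal N, F p) a := by
  have h1 : HasSum (F ∘ Finset.HasAntidiagonal.sigmaAntidiagonalEquivProd) a :=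
    (Equiv.hasSum_iff Finset.HasAntidiagonal.sigmaAntidiagonalEquivProd).mpr hF
  refine h1.sigma fun N => ?_
  have h2 := hasSum_fintype (fun c : antidiagonal N => F c)
  rw [Finset.sum_coe_sort] at h2
  convert h2 using 1
  funext c
  simp [Finset.HasAntidiagonal.sigmaAntidiagonalEquivProd]

/-- A nonnegative double series whose rows and row-sums converge: its value. [folklore] -/
theorem hasSum_prod_of_nonneg_of_rows {β γ : Type*} {F : β × γ → ℝ} (hF : 0 ≤ F) {r : β → ℝ}
    {a : ℝ} (hrow : ∀ j, HasSum (fun i => F (j, i)) (r j)) (hcol : HasSum r a) : HasSum F a := by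
  have hFs : Summable F := by
    refine (summable_prod_of_nonneg hF).2 ⟨fun j => (hrow j).summable, ?_⟩
    have : (fun j => ∑' i, F (j, i)) = r := funext fun j => (hrow j).tsum_eq
    rw [this]; exact hcol.summable
  have hval : ∑' p, F p = a := (hFs.hasSum.prod_fiberwise hrow).unique hcol
  exact hval ▸ hFs.hasSum

/-- **`C ⋆ I_{m,l} = I_{m+1,l}` in x-space**: `Σ_v I_{1,0}(v) I_{m,l}(w − v) = I_{m+1,l}(w)` for
`2(m+1)+1 ≤ d`, the family being summable (`I_{n,l} = D^{*l} ⋆ C^{*n}`).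
[cite: FitznerVanDerHofstad2016NoBLE, §3.3.3 (3.35) p. 1071 (I_{n,l}(x) = (D^{*l} * C^{*n})(x))] -/
theorem hasSum_green_mul_srwI {m : ℕ} (hd : 2 * (m + 1) + 1 ≤ d) (l : ℕ) (w : Site d) :
    HasSum (fun v => srwI d 1 0 v * srwI d m l (w - v)) (srwI d (m + 1) l w) := by
  have hd3 : 3 ≤ d := by omega
  have hdm : 2 * m + 1 ≤ d := by omega
  set G : ℕ × Site d → ℝ := fun p => SRW.prob d p.1 p.2 * srwI d m l (w - p.2) with hG
  have hG0 : 0 ≤ G := fun p => mul_nonneg (SRW.prob_nonneg _ _) (srwI_nonneg m hdm _ _)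
  have hrow : ∀ M, HasSum (fun v => G (M, v)) (srwI d m (l + M) w) := fun M => by
    have h : HasSum (fun v => SRW.prob d M v * srwI d m l (w - v))
        (∑' v, SRW.prob d M v * srwI d m l (w - v)) := (summable_prob_mul M _).hasSum
    rw [tsum_prob_mul_srwI hdm M l w] at h
    exact h
  have hcol : HasSum (fun M => srwI d m (l + M) w) (srwI d (m + 1) l w) := hasSum_srwI_tail hd l w
  have hGsum : HasSum G (srwI d (m + 1) l w) := hasSum_prod_of_nonneg_of_rows hG0 hrow hcol
  have hcolval : ∀ v, HasSum (fun M => G (M, v)) (srwI d 1 0 v * srwI d m l (w - v)) := fun v =>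
    (hasSum_prob_srwI_one hd3 v).mul_right _
  have hG' : HasSum (G ∘ (Equiv.prodComm (Site d) ℕ)) (srwI d (m + 1) l w) :=
    (Equiv.hasSum_iff _).2 hGsum
  exact hG'.prod_fiberwise fun v => by simpa using hcolval v

/-- **`I_{n+2,l}(x) = Σ_m (m+1) I_{n,l+m}(x)`** (`2(n+2)+1 ≤ d`). [folklore] -/
theorem hasSum_succ_mul_srwI {n : ℕ} (hd : 2 * (n + 2) + 1 ≤ d) (l : ℕ) (x : Site d) :
    HasSum (fun m : ℕ => ((m : ℝ) + 1) * srwI d n (l + m) x) (srwI d (n + 2) l x) := by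
  set F : ℕ × ℕ → ℝ := fun p => srwI d n (l + p.1 + p.2) x with hF
  have hF0 : 0 ≤ F := fun p => srwI_nonneg n (by omega) _ _
  have hrow : ∀ j, HasSum (fun i => F (j, i)) (srwI d (n + 1) (l + j) x) := fun j =>
    hasSum_srwI_tail (n := n) (by omega) (l + j) x
  have hcol : HasSum (fun j => srwI d (n + 1) (l + j) x) (srwI d (n + 2) l x) :=
    hasSum_srwI_tail (n := n + 1) (by omega) l x
  have h := hasSum_sum_antidiagonal (hasSum_prod_of_nonneg_of_rows hF0 hrow hcol)
  convert h using 1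
  funext N
  have : ∀ p ∈ antidiagonal N, F p = srwI d n (l + N) x := by
    intro p hp
    rw [Finset.mem_antidiagonal] at hp
    simp only [hF, ← hp, add_assoc]
  rw [Finset.sum_congr rfl this, Finset.sum_const, Finset.Nat.card_antidiagonal, nsmul_eq_mul]
  push_cast; ring

/-- **`2 I_{n+3,l}(x) = Σ_m (m+1)(m+2) I_{n,l+m}(x)`** (`2(n+3)+1 ≤ d`). [folklore] -/
theorem hasSum_succ_mul_succ_mul_srwI {n : ℕ} (hd : 2 * (n + 3) + 1 ≤ d) (l : ℕ) (x : Site d) :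
    HasSum (fun m : ℕ => ((m : ℝ) + 1) * ((m : ℝ) + 2) * srwI d n (l + m) x)
      (2 * srwI d (n + 3) l x) := by
  set F : ℕ × ℕ → ℝ := fun p => ((p.2 : ℝ) + 1) * srwI d n (l + p.1 + p.2) x with hF
  have hF0 : 0 ≤ F := fun p => mul_nonneg (by positivity) (srwI_nonneg n (by omega) _ _)
  have hrow : ∀ j, HasSum (fun i => F (j, i)) (srwI d (n + 2) (l + j) x) := fun j =>
    hasSum_succ_mul_srwI (n := n) (by omega) (l + j) x
  have hcol : HasSum (fun j => srwI d (n + 2) (l + j) x) (srwI d (n + 3) l x) :=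
    hasSum_srwI_tail (n := n + 2) (by omega) l x
  have h := (hasSum_sum_antidiagonal (hasSum_prod_of_nonneg_of_rows hF0 hrow hcol)).mul_left 2
  -- Σ_{k ≤ N} (N - k + 1) = (N+1)(N+2)/2
  have hg : ∀ M : ℕ, 2 * ∑ k ∈ Finset.range (M + 1), (((M - k : ℕ) : ℝ) + 1) =
      ((M : ℝ) + 1) * ((M : ℝ) + 2) := by
    intro M
    have hrefl := Finset.sum_range_reflect (fun j => ((j : ℝ) + 1)) (M + 1)
    simp only [add_tsub_cancel_right] at hrefl
    rw [hrefl]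
    clear hrefl
    induction M with
    | zero => norm_num
    | succ M ih =>
      rw [Finset.sum_range_succ, mul_add, ih]; push_cast; ring
  have hfun : (fun N => 2 * ∑ p ∈ antidiagonal N, F p)
      = fun m : ℕ => ((m : ℝ) + 1) * ((m : ℝ) + 2) * srwI d n (l + m) x := by
    funext N
    have : ∀ p ∈ antidiagonal N, F p = ((p.2 : ℝ) + 1) * srwI d n (l + N) x := by
      intro p hp
      rw [Finset.mem_antidiagonal] at hp
      simp only [hF, ← hp, add_assoc]
    rw [Finset.sum_congr rfl this, ← Finset.sum_mul, Finset.Nat.sum_antidiagonal_eq_sum_range_succ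
      (fun i j => ((j : ℝ) + 1)) N, ← mul_assoc, hg N]
  rw [hfun] at h
  exact h

/-! ### The weighted line `Σ_y |y|² C(y) I_{n,l}(x − y) = 𝓙_{n,l}(x)` -/

/-- `shiftTwo` is linear: constants come out. [folklore] -/
theorem shiftTwo_const_mul (c : ℝ) (f : Site d → ℝ) (x : Site d) :
    shiftTwo (fun z => c * f z) x = c * shiftTwo f x := by
  unfold shiftTwo; rw [← Finset.mul_sum, mul_div_assoc]

/-- `shiftTwo` of a difference. [folklore] -/
theorem shiftTwo_sub (f g : Site d → ℝ) (x : Site d) :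
    shiftTwo (fun z => f z - g z) x = shiftTwo f x - shiftTwo g x := by
  unfold shiftTwo; rw [Finset.sum_sub_distrib, sub_div]

/-- `2 • e_ι = axisVec ι 2`. [folklore] -/
theorem two_smul_stepVec_true (ι : Fin d) : (2 : ℕ) • SRW.stepVec (ι, true) = axisVec ι 2 := by
  funext j
  simp only [SRW.stepVec, if_true, Pi.smul_apply, Pi.single_apply, axisVec]
  split_ifs <;> simp

/-- `2 • (−e_ι) = −axisVec ι 2`. [folklore] -/
theorem two_smul_stepVec_false (ι : Fin d) : (2 : ℕ) • SRW.stepVec (ι, false) = -axisVec ι 2 := by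
  funext j
  simp only [SRW.stepVec, Pi.smul_apply, Pi.neg_apply, Pi.single_apply, axisVec,
    Bool.false_eq_true, if_false]
  split_ifs <;> simp

/-- The `±2e_ι` sum of `srwJ` is the `Dir`-indexed two-step shift sum. [folklore] -/
theorem sum_dir_shiftTwo_eq (f : Site d → ℝ) (x : Site d) :
    ∑ w : SRW.Dir d, f (x - 2 • SRW.stepVec w) = ∑ ι : Fin d, (f (x + axisVec ι 2) + f (x - axisVec ι 2)) := by
  rw [Fintype.sum_prod_type]
  refine Finset.sum_congr rfl fun ι _ => ?_
  simp only [Fintype.sum_bool]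
  rw [two_smul_stepVec_true, two_smul_stepVec_false, sub_neg_eq_add, add_comm]

/-- Translating the summation variable: `Σ_y p_m(y − v) g(x − y) = Σ_y p_m(y) g(x − v − y)`. [folklore] -/
theorem tsum_prob_shift_mul (m : ℕ) (g : Site d → ℝ) (x v : Site d) :
    ∑' y, SRW.prob d m (y - v) * g (x - y) = ∑' y, SRW.prob d m y * g (x - v - y) := by
  have h := (Equiv.subRight v).tsum_eq (fun z => SRW.prob d m z * g (x - v - z))
  simp only [Equiv.subRight_apply, sub_sub_sub_cancel_right] at h
  exact h

/-- Summability of the translated family. [folklore] -/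
theorem summable_prob_shift_mul (m : ℕ) (g : Site d → ℝ) (x v : Site d) :
    Summable fun y => SRW.prob d m (y - v) * g (x - y) := by
  have h := (Equiv.subRight v).summable_iff (f := fun z => SRW.prob d m z * g (x - v - z))
  simp only [Function.comp_def, Equiv.subRight_apply, sub_sub_sub_cancel_right] at h
  exact h.2 (summable_prob_mul m _)

/-- The `T_m` row: `Σ_y T_m(y) I_{n,l}(x − y) = S₂(I_{n,l+m})(x) − I_{n,l+m}(x)`. [folklore] -/
theorem tsum_probT_mul_srwI (hd1 : 1 ≤ d) {n : ℕ} (hd : 2 * n + 1 ≤ d) (m l : ℕ) (x : Site d) :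
    ∑' y, probT d m y * srwI d n l (x - y) =
      shiftTwo (srwI d n (l + m)) x - srwI d n (l + m) x := by
  have hd' : (2 * d : ℝ) ≠ 0 := by
    have : (1 : ℝ) ≤ d := by exact_mod_cast hd1
    positivity
  have hT : ∀ y, probT d m y * srwI d n l (x - y) =
      (∑ w, SRW.prob d m (y - 2 • SRW.stepVec w) * srwI d n l (x - y)) / (2 * d)
        - SRW.prob d m y * srwI d n l (x - y) := by
    intro y; unfold probT shiftTwo; rw [sub_mul, div_mul_eq_mul_div, Finset.sum_mul]
  simp_rw [hT]
  have hS1 : Summable fun y =>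
      (∑ w, SRW.prob d m (y - 2 • SRW.stepVec w) * srwI d n l (x - y)) / (2 * d) :=
    (summable_sum fun w _ => summable_prob_shift_mul m (srwI d n l) x _).div_const _
  rw [hS1.tsum_sub (summable_prob_mul m _), tsum_prob_mul_srwI hd, tsum_div_const,
    Summable.tsum_finsetSum (fun w _ => summable_prob_shift_mul m (srwI d n l) x _)]
  unfold shiftTwo
  congr 2
  refine Finset.sum_congr rfl fun w _ => ?_
  rw [tsum_prob_shift_mul, tsum_prob_mul_srwI hd]

/-- The rows of the weighted line: `Σ_y |y|² p_m(y) I_{n,l}(x − y)` for `m = 0`, `1`, `m + 2`. [folklore] -/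
theorem tsum_normSq_mul_prob_mul_srwI (hd1 : 1 ≤ d) {n : ℕ} (hd : 2 * n + 1 ≤ d) (l : ℕ) (x : Site d) :
    (∑' y, normSq y * SRW.prob d 0 y * srwI d n l (x - y) = 0) ∧
    (∑' y, normSq y * SRW.prob d 1 y * srwI d n l (x - y) = srwI d n (l + 1) x) ∧
    (∀ m, ∑' y, normSq y * SRW.prob d (m + 2) y * srwI d n l (x - y) =
      (m + 2) * srwI d n (l + (m + 2)) x
        + (m + 2) * (m + 1) / (2 * d) * (shiftTwo (srwI d n (l + m)) x - srwI d n (l + m) x)) := by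
  refine ⟨?_, ?_, fun m => ?_⟩
  · simp_rw [normSq_mul_prob_zero, zero_mul]; exact tsum_zero
  · simp_rw [normSq_mul_prob_one hd1]; exact tsum_prob_mul_srwI hd 1 l x
  · have hT : ∀ y, probT d m y * srwI d n l (x - y) =
        (∑ w, SRW.prob d m (y - 2 • SRW.stepVec w) * srwI d n l (x - y)) / (2 * d)
          - SRW.prob d m y * srwI d n l (x - y) := by
      intro y; unfold probT shiftTwo; rw [sub_mul, div_mul_eq_mul_div, Finset.sum_mul]
    have hS2 : Summable fun y => probT d m y * srwI d n l (x - y) := by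
      simp_rw [hT]
      exact ((summable_sum fun w _ => summable_prob_shift_mul m (srwI d n l) x _).div_const _).sub
        (summable_prob_mul m _)
    have hy : ∀ y, normSq y * SRW.prob d (m + 2) y * srwI d n l (x - y) =
        (m + 2) * (SRW.prob d (m + 2) y * srwI d n l (x - y))
          + (m + 2) * (m + 1) / (2 * d) * (probT d m y * srwI d n l (x - y)) := by
      intro y; rw [normSq_mul_prob_add_two hd1]; ring
    simp_rw [hy]
    rw [((summable_prob_mul _ _).mul_left _).tsum_add (hS2.mul_left _), tsum_mul_left,
      tsum_mul_left, tsum_prob_mul_srwI hd, tsum_probT_mul_srwI hd1 hd]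

/-- **The weighted SRW line is `𝓙`** ([NoBLE17] (3.29)–(3.30), x-space form): for `2(n+3)+1 ≤ d`,
`Σ_y |y|² I_{1,0}(y) I_{n,l}(x − y) = 𝓙_{n,l}(x) = srwJ d (n+2) l x`, the family being summable
(`I_{1,0} = C_{1/(2d)}` is the critical SRW Green's function, `hasSum_prob_srwI_one`).
[cite: FitznerVanDerHofstad2016NoBLE, §3.3.3 (3.28)–(3.30) p. 1070] -/
theorem hasSum_weightedLine {n : ℕ} (hd : 2 * (n + 3) + 1 ≤ d) (l : ℕ) (x : Site d) :
    HasSum (fun y => normSq y * srwI d 1 0 y * srwI d n l (x - y)) (srwJ d (n + 2) l x) := by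
  have hd1 : 1 ≤ d := by omega
  have hd3 : 3 ≤ d := by omega
  have hdn : 2 * n + 1 ≤ d := by omega
  have hd' : (2 * d : ℝ) ≠ 0 := by
    have : (1 : ℝ) ≤ d := by exact_mod_cast hd1
    positivity
  -- the double family
  set G : ℕ × Site d → ℝ := fun p => normSq p.2 * SRW.prob d p.1 p.2 * srwI d n l (x - p.2) with hG
  have hG0 : 0 ≤ G := fun p =>
    mul_nonneg (mul_nonneg (normSq_nonneg _) (SRW.prob_nonneg _ _)) (srwI_nonneg n hdn _ _)
  -- row values
  obtain ⟨hr0, hr1, hr2⟩ := tsum_normSq_mul_prob_mul_srwI hd1 hdn l x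
  set a : ℕ → ℝ := fun m => (m : ℝ) * srwI d n (l + m) x with ha
  set b : ℕ → ℝ := fun m => (m : ℝ) * ((m : ℝ) - 1) / (2 * d) *
    (shiftTwo (srwI d n (l + m - 2)) x - srwI d n (l + m - 2) x) with hb
  have hrowsum : ∀ m, Summable fun y => G (m, y) := fun m => by
    have : (fun y => G (m, y)) = fun y => SRW.prob d m y * (normSq y * srwI d n l (x - y)) := by
      funext y; simp only [hG]; ring
    rw [this]; exact summable_prob_mul m _
  have hrowval : ∀ m, ∑' y, G (m, y) = a m + b m := by
    intro m
    match m with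
    | 0 => simp [hG, ha, hb, hr0]
    | 1 => simp [hG, ha, hb, hr1]
    | m + 2 =>
      simp only [hG, ha, hb]
      rw [hr2 m, show l + (m + 2) - 2 = l + m by omega]
      push_cast; ring
  have hrow : ∀ m, HasSum (fun y => G (m, y)) (a m + b m) := fun m =>
    hrowval m ▸ (hrowsum m).hasSum
  -- the column series
  have haS : HasSum a (srwI d (n + 2) (l + 1) x) := by
    have h := hasSum_succ_mul_srwI (n := n) (by omega) (l + 1) x
    have hfun : (fun m => a (m + 1)) = fun m : ℕ => ((m : ℝ) + 1) * srwI d n (l + 1 + m) x := by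
      funext m
      simp only [ha, show l + (m + 1) = l + 1 + m by omega]
      push_cast; ring
    have h' : HasSum (fun m => a (m + 1)) (srwI d (n + 2) (l + 1) x) := by rw [hfun]; exact h
    have := (hasSum_nat_add_iff (f := a) 1).1 h'
    simpa [ha] using this
  have hbS : HasSum b ((shiftTwo (fun z => 2 * srwI d (n + 3) l z) x - 2 * srwI d (n + 3) l x)
      / (2 * d)) := by
    have h3 : ∀ z, HasSum (fun m : ℕ => ((m : ℝ) + 1) * ((m : ℝ) + 2) * srwI d n (l + m) z)
        (2 * srwI d (n + 3) l z) := fun z => hasSum_succ_mul_succ_mul_srwI hd l z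
    have hS : HasSum (fun m : ℕ => shiftTwo (fun z => ((m : ℝ) + 1) * ((m : ℝ) + 2)
        * srwI d n (l + m) z) x) (shiftTwo (fun z => 2 * srwI d (n + 3) l z) x) := by
      unfold shiftTwo
      exact (hasSum_sum fun w _ => h3 (x - 2 • SRW.stepVec w)).div_const _
    have hfun : (fun m => b (m + 2)) = fun m : ℕ =>
        (shiftTwo (fun z => ((m : ℝ) + 1) * ((m : ℝ) + 2) * srwI d n (l + m) z) x
          - ((m : ℝ) + 1) * ((m : ℝ) + 2) * srwI d n (l + m) x) / (2 * d) := by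
      funext m
      simp only [hb]
      rw [show l + (m + 2) - 2 = l + m by omega, shiftTwo_const_mul]
      push_cast; ring
    have h' : HasSum (fun m => b (m + 2)) ((shiftTwo (fun z => 2 * srwI d (n + 3) l z) x
        - 2 * srwI d (n + 3) l x) / (2 * d)) := by
      rw [hfun]; exact (hS.sub (h3 x)).div_const (2 * (d : ℝ))
    have := (hasSum_nat_add_iff (f := b) 2).1 h'
    simpa [hb, Finset.sum_range_succ] using this
  have hval : srwI d (n + 2) (l + 1) x + (shiftTwo (fun z => 2 * srwI d (n + 3) l z) x
      - 2 * srwI d (n + 3) l x) / (2 * d) = srwJ d (n + 2) l x := by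
    rw [srwJ_def, shiftTwo_const_mul]
    unfold shiftTwo
    rw [sum_dir_shiftTwo_eq]
    field_simp
    ring
  have hcol : HasSum (fun m => a m + b m) (srwJ d (n + 2) l x) := by
    have := haS.add hbS
    rw [hval] at this
    exact this
  have hGsum : HasSum G (srwJ d (n + 2) l x) := hasSum_prod_of_nonneg_of_rows hG0 hrow hcol
  -- columns: Σ_m G (m, y) = |y|² I_{1,0}(y) I_{n,l}(x - y)
  have hcolval : ∀ y, HasSum (fun m => G (m, y)) (normSq y * srwI d 1 0 y * srwI d n l (x - y)) := by
    intro y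
    have h := ((hasSum_prob_srwI_one hd3 y).mul_left (normSq y)).mul_right (srwI d n l (x - y))
    exact h
  have hG' : HasSum (G ∘ (Equiv.prodComm (Site d) ℕ)) (srwJ d (n + 2) l x) :=
    (Equiv.hasSum_iff _).2 hGsum
  exact hG'.prod_fiberwise fun y => by simpa using hcolval y

/-- Corollary: the value, `Σ_y |y|² I_{1,0}(y) I_{n,l}(x − y) = srwJ d (n+2) l x`.
[cite: FitznerVanDerHofstad2016NoBLE, §3.3.3 (3.29)–(3.30) p. 1070] -/
theorem tsum_weightedLine_eq_srwJ {n : ℕ} (hd : 2 * (n + 3) + 1 ≤ d) (l : ℕ) (x : Site d) :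
    ∑' y, normSq y * srwI d 1 0 y * srwI d n l (x - y) = srwJ d (n + 2) l x :=
  (hasSum_weightedLine hd l x).tsum_eq

/-- Corollary: **`𝓙_{n,l}(x) ≥ 0`** for `2(n+3)+1 ≤ d` (it is a sum of nonnegative terms).
[cite: FitznerVanDerHofstad2016NoBLE, §3.3.3 (3.29)–(3.30) p. 1070] -/
theorem srwJ_nonneg {n : ℕ} (hd : 2 * (n + 3) + 1 ≤ d) (l : ℕ) (x : Site d) :
    0 ≤ srwJ d (n + 2) l x :=
  (hasSum_weightedLine hd l x).nonneg fun y =>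
    mul_nonneg (mul_nonneg (normSq_nonneg _) (srwI_nonneg 1 (by omega) _ _))
      (srwI_nonneg n (by omega) _ _)

end Literature.Probability.FitznerVanDerHofstad2017
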